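import Mathlib.Tactic
import HarnessLib
import HarnessLib.Audit.Tags
import Summits.CriticalPhenomena.PercolationContinuityZ3.Theorems.PercNearOneGluingNoHeavyLowerTailSahiAntichainSplitStep

/-!
# Antichains: meets plus joins — constant cross labels pay on the other side; the two-member step (members containing `r`)

Support file (seat `prim-masterthm-p1`, gen 35; `--supports stmt-CriticalPhenomena-4575`).  No `sorry`, standard axioms.  Builds on `…SahiAntichainSplit`
(split identity, one-sided step) and `…SahiAntichainSplitStep` (split step).  Companion `…SahiAntichainSplitFive` (the dual two-member step and V5 for
`#P ≤ 5`).  Memo `run/shared/lean/prim/prim-masterthm/FROM-prim-masterthm-p1-g35-SPLIT-STEP.md`.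

NEW HERE ([this work], gen 35).
* `eq_of_inter_eq_of_union_eq`: lattice cancellation (`b` is determined by `a ∩ b` and `a ∪ b`).
* **Constant cross joins through one member pay in meets** (`card_below_le_card_newMeets_of_union_const`): if, for some member `a ∋ r`, all cross joins
  `a ∪ b` (`b ∌ r`) coincide, then the traces `a ∩ b` are pairwise distinct NEW cross meets, so `#newMeets P r ≥ #below P r`; dually
  `card_above_le_card_newJoins_of_inter_const`.
* **The two-member step** (`two_le_newLabels_of_card_above_eq_two`): if exactly two members `a, a'` of an antichain contain `r` and at least two avoid it,
  the split at `r` creates at least two new labels.  Proof: either some member has constant cross joins (previous lemma), or there are three cross joins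
  (two are new, as `joins {a,a'} = {a ∪ a'}`), or the cross joins are exactly `a ∪ a' ⊊ W₂`; then `a ∪ b = a' ∪ b` for every `b`, every `b` contains
  `a' \ a ≠ ∅` (so no trace `a ∩ b` is a meet of two members avoiding `r`), and `b ↦ a ∩ b` is injective (equal traces with comparable joins give comparable
  members) — again `#below` new cross meets.
HONEST FRAMING: V5 in general remains OPEN; everything here is unconditional. [this work]
-/

namespace Summit.CriticalPhenomena.PercolationContinuityZ3.Theorems.SahiColouredDaykin

open Finset

variable {α : Type*} [DecidableEq α]

/-! ### 1. Constant cross joins through one member pay in meets (and dually) -/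

/-- Lattice cancellation for sets: `b` is recovered from `a ∩ b` and `a ∪ b`. [this work] -/
theorem eq_of_inter_eq_of_union_eq {a b b' : Finset α} (hi : a ∩ b = a ∩ b') (hu : a ∪ b = a ∪ b') : b = b' := by
  ext x
  by_cases hxa : x ∈ a
  · constructor
    · intro hxb
      have : x ∈ a ∩ b' := by rw [← hi]; exact mem_inter.2 ⟨hxa, hxb⟩
      exact (mem_inter.1 this).2
    · intro hxb'
      have : x ∈ a ∩ b := by rw [hi]; exact mem_inter.2 ⟨hxa, hxb'⟩
      exact (mem_inter.1 this).2
  · constructor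
    · intro hxb
      have : x ∈ a ∪ b' := by rw [← hu]; exact mem_union_right _ hxb
      rcases mem_union.1 this with h | h
      · exact absurd h hxa
      · exact h
    · intro hxb'
      have : x ∈ a ∪ b := by rw [hu]; exact mem_union_right _ hxb'
      rcases mem_union.1 this with h | h
      · exact absurd h hxa
      · exact h

/-- **Constant cross joins through `a` pay in meets.**  If `a ∋ r` is a member and all cross joins `a ∪ b` (`b ∌ r`) equal `W`, then `b ↦ a ∩ b` is
injective on `below P r` and no trace `a ∩ b` is a meet of two members avoiding `r`; hence `#below P r ≤ #newMeets P r`. [this work] -/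
theorem card_below_le_card_newMeets_of_union_const {P : Finset (Finset α)} {r : α} {a W : Finset α}
    (hanti : IsAntichain (· ⊆ ·) (P : Set (Finset α))) (ha : a ∈ above P r) (hW : ∀ b ∈ below P r, a ∪ b = W) :
    #(below P r) ≤ #(newMeets P r) := by
  obtain ⟨haP, hra⟩ := mem_above_iff.1 ha
  have hinj : Set.InjOn (fun b => a ∩ b) (below P r : Set (Finset α)) := by
    intro b hb b' hb' h
    exact eq_of_inter_eq_of_union_eq h ((hW b (mem_coe.1 hb)).trans (hW b' (mem_coe.1 hb')).symm)
  rw [← card_image_of_injOn hinj]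
  apply card_le_card
  intro Z hZ
  obtain ⟨b, hb, rfl⟩ := mem_image.1 hZ
  obtain ⟨hbP, hrb⟩ := mem_below_iff.1 hb
  unfold newMeets
  refine mem_sdiff.2 ⟨mem_crossMeets_iff.2 ⟨a, haP, b, hbP, hra, hrb, rfl⟩, ?_⟩
  intro hold
  obtain ⟨d, hd, d', hd', _, he⟩ := mem_meets_iff.1 hold
  have hud : a ∪ d = a ∪ b := (hW d hd).trans (hW b hb).symm
  have hud' : a ∪ d' = a ∪ b := (hW d' hd').trans (hW b hb).symm
  -- b \ a ⊆ d ∩ d' = a ∩ b ⊆ a forces b ⊆ a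
  have hba : b ⊆ a := by
    intro x hxb
    by_contra hxa
    have hxd : x ∈ d := by
      have : x ∈ a ∪ d := by rw [hud]; exact mem_union_right _ hxb
      rcases mem_union.1 this with h | h
      · exact absurd h hxa
      · exact h
    have hxd' : x ∈ d' := by
      have : x ∈ a ∪ d' := by rw [hud']; exact mem_union_right _ hxb
      rcases mem_union.1 this with h | h
      · exact absurd h hxa
      · exact h
    have : x ∈ a ∩ b := by rw [he]; exact mem_inter.2 ⟨hxd, hxd'⟩
    exact hxa (mem_inter.1 this).1
  have hne : b ≠ a := by rintro rfl; exact hrb hra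
  exact hanti (mem_coe.2 hbP) (mem_coe.2 haP) hne hba

/-- **Constant cross meets through `b` pay in joins** (the dual statement). [this work] -/
theorem card_above_le_card_newJoins_of_inter_const {P : Finset (Finset α)} {r : α} {b Z : Finset α}
    (hanti : IsAntichain (· ⊆ ·) (P : Set (Finset α))) (hb : b ∈ below P r) (hZ : ∀ a ∈ above P r, a ∩ b = Z) :
    #(above P r) ≤ #(newJoins P r) := by
  obtain ⟨hbP, hrb⟩ := mem_below_iff.1 hb
  have hinj : Set.InjOn (fun a => a ∪ b) (above P r : Set (Finset α)) := by
    intro a ha a' ha' h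
    have hi : b ∩ a = b ∩ a' := by
      rw [inter_comm b a, inter_comm b a']
      exact (hZ a (mem_coe.1 ha)).trans (hZ a' (mem_coe.1 ha')).symm
    have hu : b ∪ a = b ∪ a' := by
      rw [union_comm b a, union_comm b a']
      exact h
    exact eq_of_inter_eq_of_union_eq hi hu
  rw [← card_image_of_injOn hinj]
  apply card_le_card
  intro W hW
  obtain ⟨a, ha, rfl⟩ := mem_image.1 hW
  obtain ⟨haP, hra⟩ := mem_above_iff.1 ha
  unfold newJoins
  refine mem_sdiff.2 ⟨mem_crossJoins_iff.2 ⟨a, haP, b, hbP, hra, hrb, rfl⟩, ?_⟩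
  intro hold
  obtain ⟨c, hc, c', hc', hcc', he⟩ := mem_joins_iff.1 hold
  have hic : c ∩ b = a ∩ b := (hZ c hc).trans (hZ a ha).symm
  have hic' : c' ∩ b = a ∩ b := (hZ c' hc').trans (hZ a ha).symm
  have hsub : ∀ {e : Finset α}, e ∈ P → e ∩ b = a ∩ b → e ⊆ a ∪ b → e = a := by
    intro e heP hie heu
    have hea : e ⊆ a := by
      intro x hxe
      by_cases hxb : x ∈ b
      · have : x ∈ a ∩ b := by rw [← hie]; exact mem_inter.2 ⟨hxe, hxb⟩
        exact (mem_inter.1 this).1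
      · rcases mem_union.1 (heu hxe) with h | h
        · exact h
        · exact absurd h hxb
    by_contra hne
    exact hanti (mem_coe.2 heP) (mem_coe.2 haP) hne hea
  have hcu : c ⊆ a ∪ b := by rw [he]; exact subset_union_left
  have hc'u : c' ⊆ a ∪ b := by rw [he]; exact subset_union_right
  exact hcc' ((hsub (above_subset P r hc) hic hcu).trans (hsub (above_subset P r hc') hic' hc'u).symm)

/-! ### 2. The two-member step -/

/-- **Two-member step (exactly two members contain `r`).** [this work] -/
theorem two_le_newLabels_of_card_above_eq_two {P : Finset (Finset α)} {r : α}
    (hanti : IsAntichain (· ⊆ ·) (P : Set (Finset α))) (h2 : #(above P r) = 2) (hq : 2 ≤ #(below P r)) :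
    2 ≤ newLabels P r := by
  obtain ⟨a, a', hne, hA⟩ := card_eq_two.1 h2
  have ha : a ∈ above P r := by rw [hA]; simp
  have ha' : a' ∈ above P r := by rw [hA]; simp
  obtain ⟨haP, hra⟩ := mem_above_iff.1 ha
  obtain ⟨ha'P, hra'⟩ := mem_above_iff.1 ha'
  unfold newLabels
  -- Case 1: constant cross joins through `a` or through `a'`
  by_cases hca : ∀ b ∈ below P r, ∀ b' ∈ below P r, a ∪ b = a ∪ b'
  · obtain ⟨b₀, hb₀⟩ : (below P r).Nonempty := card_pos.1 (by omega)
    have := card_below_le_card_newMeets_of_union_const (W := a ∪ b₀) hanti ha (fun b hb => hca b hb b₀ hb₀)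
    omega
  by_cases hca' : ∀ b ∈ below P r, ∀ b' ∈ below P r, a' ∪ b = a' ∪ b'
  · obtain ⟨b₀, hb₀⟩ : (below P r).Nonempty := card_pos.1 (by omega)
    have := card_below_le_card_newMeets_of_union_const (W := a' ∪ b₀) hanti ha' (fun b hb => hca' b hb b₀ hb₀)
    omega
  push Not at hca hca'
  obtain ⟨b₁, hb₁, b₂, hb₂, hne12⟩ := hca
  -- the inner joins: only `a ∪ a'`
  have hJ : joins (above P r) = {a ∪ a'} := by
    apply Subset.antisymm
    · intro W hW
      obtain ⟨c, hc, c', hc', hcc', hWe⟩ := mem_joins_iff.1 hW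
      rw [hWe, mem_singleton]
      rw [hA, mem_insert, mem_singleton] at hc hc'
      rcases hc with h1 | h1 <;> rcases hc' with h2 | h2
      · exact absurd (h1.trans h2.symm) hcc'
      · rw [h1, h2]
      · rw [h1, h2, union_comm]
      · exact absurd (h1.trans h2.symm) hcc'
    · intro W hW
      rw [mem_singleton.1 hW]
      exact mem_joins_iff.2 ⟨a, ha, a', ha', hne, rfl⟩
  have hnewJ : newJoins P r = crossJoins P r \ {a ∪ a'} := by unfold newJoins; rw [hJ]
  -- membership of the basic cross joins
  have hY : ∀ {c b}, c ∈ above P r → b ∈ below P r → c ∪ b ∈ crossJoins P r := by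
    intro c b hc hb
    exact mem_crossJoins_iff.2 ⟨c, (mem_above_iff.1 hc).1, b, (mem_below_iff.1 hb).1, (mem_above_iff.1 hc).2, (mem_below_iff.1 hb).2, rfl⟩
  -- Case 2: three distinct cross joins ⟹ two new ones
  by_cases h3 : ∃ W ∈ crossJoins P r, W ≠ a ∪ b₁ ∧ W ≠ a ∪ b₂
  · obtain ⟨W, hW, hW1, hW2⟩ := h3
    have hsub : ({a ∪ b₁, a ∪ b₂, W} : Finset (Finset α)) ⊆ crossJoins P r := by
      intro V hV
      simp only [mem_insert, mem_singleton] at hV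
      rcases hV with rfl | rfl | rfl
      · exact hY ha hb₁
      · exact hY ha hb₂
      · exact hW
    have hc3 : #({a ∪ b₁, a ∪ b₂, W} : Finset (Finset α)) = 3 := by
      rw [card_insert_of_notMem, card_pair (Ne.symm hW2)]
      simp only [mem_insert, mem_singleton, not_or]
      exact ⟨hne12, Ne.symm hW1⟩
    have h3le : 3 ≤ #(crossJoins P r) := hc3 ▸ card_le_card hsub
    have : 2 ≤ #(newJoins P r) := by
      rw [hnewJ]
      have := le_card_sdiff ({a ∪ a'} : Finset (Finset α)) (crossJoins P r)
      rw [card_singleton] at this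
      omega
    omega
  · -- Case 3: the cross joins are exactly `{a ∪ b₁, a ∪ b₂}`
    push Not at h3
    have hYeq : ∀ W ∈ crossJoins P r, W = a ∪ b₁ ∨ W = a ∪ b₂ := by
      intro W hW
      by_cases h : W = a ∪ b₁
      · exact Or.inl h
      · exact Or.inr (h3 W hW h)
    -- if neither equals `a ∪ a'`, both are new
    by_cases hW1 : a ∪ b₁ ≠ a ∪ a' ∧ a ∪ b₂ ≠ a ∪ a'
    · have hsub : ({a ∪ b₁, a ∪ b₂} : Finset (Finset α)) ⊆ newJoins P r := by
        rw [hnewJ]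
        intro V hV
        simp only [mem_insert, mem_singleton] at hV
        rcases hV with rfl | rfl
        · exact mem_sdiff.2 ⟨hY ha hb₁, by rw [mem_singleton]; exact hW1.1⟩
        · exact mem_sdiff.2 ⟨hY ha hb₂, by rw [mem_singleton]; exact hW1.2⟩
      have := card_le_card hsub
      rw [card_pair hne12] at this
      omega
    · -- one of the two cross joins is `W₁ = a ∪ a'`; call the other `W₂`; then `W₁ ⊊ W₂`... we show: all traces of `a` are distinct new cross meets
      -- Step (i): every cross join through `a'` is also a cross join through `a`, hence `a ∪ b = a' ∪ b` and both contain `a ∪ a'` or ...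
      -- We prove directly the two facts needed: (F1) every `b ∈ below` contains `a' \ a`; (F2) `b ↦ a ∩ b` is injective on `below`.
      have hWa' : ∀ b ∈ below P r, a' ∪ b = a ∪ b₁ ∨ a' ∪ b = a ∪ b₂ := fun b hb => hYeq _ (hY ha' hb)
      have hWa : ∀ b ∈ below P r, a ∪ b = a ∪ b₁ ∨ a ∪ b = a ∪ b₂ := fun b hb => hYeq _ (hY ha hb)
      -- name W₁ = a ∪ a' and W₂ the other value
      have hone : a ∪ b₁ = a ∪ a' ∨ a ∪ b₂ = a ∪ a' := by
        by_contra h; push Not at h; exact hW1 h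
      -- both values contain `a'`: each is some `a' ∪ b`
      obtain ⟨c₁, hc₁, c₂, hc₂, hne'⟩ := hca'
      have hval : ∀ V, (V = a ∪ b₁ ∨ V = a ∪ b₂) → a ⊆ V := by
        rintro V (rfl | rfl) <;> exact subset_union_left
      have hval' : a' ⊆ a ∪ b₁ ∧ a' ⊆ a ∪ b₂ := by
        -- the two values of `a' ∪ ·` are distinct and among {a∪b₁, a∪b₂}, so both occur
        rcases hWa' c₁ hc₁ with h1 | h1 <;> rcases hWa' c₂ hc₂ with h2 | h2
        · exact absurd (h1.trans h2.symm) hne'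
        · exact ⟨h1 ▸ subset_union_left, h2 ▸ subset_union_left⟩
        · exact ⟨h2 ▸ subset_union_left, h1 ▸ subset_union_left⟩
        · exact absurd (h1.trans h2.symm) hne'
      -- hence both cross-join values contain `a ∪ a'`
      have hsup1 : a ∪ a' ⊆ a ∪ b₁ := union_subset subset_union_left hval'.1
      have hsup2 : a ∪ a' ⊆ a ∪ b₂ := union_subset subset_union_left hval'.2
      -- (F0) for every b: a ∪ b = a' ∪ b
      have hF0 : ∀ b ∈ below P r, a ∪ b = a' ∪ b := by
        intro b hb
        have h1 : a' ⊆ a ∪ b := by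
          rcases hWa b hb with h | h
          · rw [h]; exact hval'.1
          · rw [h]; exact hval'.2
        have h2 : a ⊆ a' ∪ b := by
          rcases hWa' b hb with h | h
          · rw [h]; exact subset_union_left
          · rw [h]; exact subset_union_left
        exact Subset.antisymm (union_subset h2 subset_union_right) (union_subset h1 subset_union_right)
      -- (F1) every b contains a' \ a
      have hF1 : ∀ b ∈ below P r, a' \ a ⊆ b := by
        intro b hb x hx
        obtain ⟨hxa', hxa⟩ := mem_sdiff.1 hx
        have : x ∈ a ∪ b := by rw [hF0 b hb]; exact mem_union_left _ hxa'
        rcases mem_union.1 this with h | h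
        · exact absurd h hxa
        · exact h
      -- (F2) injectivity of the trace on `below`
      have hF2 : Set.InjOn (fun b => a ∩ b) (below P r : Set (Finset α)) := by
        intro b hb b' hb' h
        simp only [mem_coe] at hb hb'
        by_contra hbb
        -- the unions differ (else cancellation), so they are the two comparable values and b ⊊ b' or b' ⊊ b
        have hu : a ∪ b ≠ a ∪ b' := fun hu => hbb (eq_of_inter_eq_of_union_eq h hu)
        -- general fact: if a ∪ b ⊆ a ∪ b' and a ∩ b = a ∩ b' then b ⊆ b'
        have key : ∀ {b b' : Finset α}, b ∈ below P r → b' ∈ below P r → a ∩ b = a ∩ b' → a ∪ b ⊆ a ∪ b' → b = b' := by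
          intro b b' hb hb' hi hsub
          have hbb' : b ⊆ b' := by
            intro x hxb
            by_cases hxa : x ∈ a
            · have : x ∈ a ∩ b' := by rw [← hi]; exact mem_inter.2 ⟨hxa, hxb⟩
              exact (mem_inter.1 this).2
            · rcases mem_union.1 (hsub (mem_union_right _ hxb)) with hx | hx
              · exact absurd hx hxa
              · exact hx
          by_contra hne2
          exact hanti (mem_coe.2 (mem_below_iff.1 hb).1) (mem_coe.2 (mem_below_iff.1 hb').1) hne2 hbb'
        -- the two values are W₁ = a ∪ a' ⊆ W₂; decide which of b, b' has the smaller union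
        rcases hone with h1 | h1
        · -- a ∪ b₁ = a ∪ a' ⊆ a ∪ b₂
          have hle : a ∪ b₁ ⊆ a ∪ b₂ := h1 ▸ hsup2
          rcases hWa b hb with hb1 | hb2 <;> rcases hWa b' hb' with hb'1 | hb'2
          · exact hu (hb1.trans hb'1.symm)
          · exact hbb (key hb hb' h (by rw [hb1, hb'2]; exact hle))
          · exact (Ne.symm hbb) (key hb' hb h.symm (by rw [hb'1, hb2]; exact hle))
          · exact hu (hb2.trans hb'2.symm)
        · have hle : a ∪ b₂ ⊆ a ∪ b₁ := h1 ▸ hsup1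
          rcases hWa b hb with hb1 | hb2 <;> rcases hWa b' hb' with hb'1 | hb'2
          · exact hu (hb1.trans hb'1.symm)
          · exact (Ne.symm hbb) (key hb' hb h.symm (by rw [hb'2, hb1]; exact hle))
          · exact hbb (key hb hb' h (by rw [hb2, hb'1]; exact hle))
          · exact hu (hb2.trans hb'2.symm)
      -- the traces are new cross meets
      have hsub : (below P r).image (fun b => a ∩ b) ⊆ newMeets P r := by
        intro Z hZ
        obtain ⟨b, hb, rfl⟩ := mem_image.1 hZ
        obtain ⟨hbP, hrb⟩ := mem_below_iff.1 hb
        unfold newMeets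
        refine mem_sdiff.2 ⟨mem_crossMeets_iff.2 ⟨a, haP, b, hbP, hra, hrb, rfl⟩, ?_⟩
        intro hold
        obtain ⟨d, hd, d', hd', _, he⟩ := mem_meets_iff.1 hold
        -- a' \ a is nonempty (antichain) and contained in d ∩ d' = a ∩ b ⊆ a
        have hna : ¬ a' ⊆ a := fun h => hanti (mem_coe.2 ha'P) (mem_coe.2 haP) (Ne.symm hne) h
        obtain ⟨x, hxa', hxa⟩ := not_subset.1 hna
        have hx : x ∈ a' \ a := mem_sdiff.2 ⟨hxa', hxa⟩
        have : x ∈ a ∩ b := by rw [he]; exact mem_inter.2 ⟨hF1 d hd hx, hF1 d' hd' hx⟩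
        exact hxa (mem_inter.1 this).1
      have := card_le_card hsub
      rw [card_image_of_injOn hF2] at this
      omega

end Summit.CriticalPhenomena.PercolationContinuityZ3.Theorems.SahiColouredDaykin
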